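import Summits.BirchSwinnertonDyer.BirchSwinnertonDyer.Theorems.QuadraticBranchSignedControlPlusEtaNonsurjCartanFieldLine
import Mathlib.FieldTheory.Galois.Infinite
import Mathlib.FieldTheory.KrullTopology
import Mathlib.FieldTheory.Perfect
import HarnessLib

/-!
# Route `QuadraticBranchSignedControl` (rung K8, cell `bsd-potss`): crux stmt-BirchSwinnertonDyer-19606
# `PlusEtaMainConjectureNonsurj` — THE CARTAN FIELD `K_V` AS AN OBJECT: a quadratic subfield of `ℚ̄` whose fixing group is the
# Cartan subgroup `H_V` (infinite Galois correspondence applied to the OPEN index-`2` subgroup `H_V`)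

WHAT. k8eta-c2 g9/g10 describe the Cartan subgroup `H_V ≤ Γ_ℚ` of a row of crux 19606 intrinsically (`σ` centralises the squares on
`V[p]`) and speak of "its fixed field, the Cartan field `K_V`" only in docstrings. For the next typed step — a Hecke character of `K_V`
(`HeckeCharacter K` needs `K` a number FIELD) whose CM newform anchors the row (FINDING-19606-k8eta-c2-g10) — `K_V` must exist as an
object. This file supplies it, with no definition: `exists_cartanField_of_row` — there is an intermediate field
`K ≤ ℚ̄ = AlgebraicClosure ℚ` with `[K : ℚ] = 2` whose fixing subgroup `Gal(ℚ̄/K)` is EXACTLY `H_V` (membership ⟺ centralises the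
squares). Ingredients: the residual cell's open index-`2` subgroup `U = ρ̄⁻¹Φ⁻¹(kˣ)` (`GaloisImage.exists_index_two_subgroup_of_goodSS_of_not_surj`:
open, index `2`), g10's bridge `apply_mem_unitGroup_iff_centralizes_sq` (`U = H_V`), an open subgroup is closed, and Mathlib's infinite Galois
correspondence (`InfiniteGalois.fixingSubgroup_fixedField`, `IntermediateField.finrank_eq_fixingSubgroup_index`).

HONEST FRAMING (cell `bsd-potss`, run/shared/lean/pub/bsd-potss/): TOOL THEOREM ONLY (no definition, no named fact, no `sorry`, axioms standard).
Nothing is booked; crux 19606 stays OPEN; `BSD(W, p)` is claimed for no pair. Seat `bsd-potss-k8eta-c2` g10 (prover),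
`--supports stmt-BirchSwinnertonDyer-19606`.

References: [Serre1972] §2.2, §4.2 c); [NeukirchANT1999] Ch. IV §1 (infinite Galois theory); [Zywina2015] Thm. 1.4 (`K_V` on `X_ns⁺(5)`);
S. Frengley, arXiv:2111.05813, Lemma 28.
-/

set_option autoImplicit false
set_option linter.dupNamespace false

noncomputable section

open scoped Classical NumberField Pointwise

open Matrix Field IsDedekindDomain NumberField WeierstrassCurve Literature.NumberTheory.EllipticCurves
  Literature.NumberTheory.GaloisRepresentations Literature.NumberTheory.GaloisRepresentations.Serre1972
  Literature.NumberTheory.SerreUniformity Literature.NumberTheory.EllipticCurves.Rank1Residual Rat.HeightOneSpectrum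
open Summit.BirchSwinnertonDyer.Rank1Residual.GaloisImage

namespace Summit.BirchSwinnertonDyer.BirchSwinnertonDyer.Theorems.EtaCartanField

/-- **The Cartan field of a row of crux 19606, as an object.** For `V/ℚ` globally minimal, `p ≥ 5` good with `a_p = 0` and `p`-adic
tower not onto, there is an intermediate field `K` of `ℚ̄/ℚ` of degree `2` — the CARTAN FIELD `K_V` — such that for every
`σ ∈ Γ_ℚ`: `σ` fixes `K` pointwise iff `σ` centralises the squares on `V[p]` (i.e. `Gal(ℚ̄/K) = H_V = ρ̄⁻¹(C_ns(p))`). By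
`…CartanFieldInert` / `…CartanFieldImaginary` / `…CartanFieldLine`, `K` is an imaginary quadratic field, unramified at `p` and outside
the additive primes of `V`, in which `p` is inert, and `ρ̄_{V,p}|_{Gal(ℚ̄/K)}` is a character. [cite: Serre1972, §2.2, §4.2 c)]
[cite: Zywina2015, Thm. 1.4] -/
theorem exists_cartanField_of_row (V : WeierstrassCurve ℚ) [V.IsElliptic] [V.IsGloballyMinimal] (p : ℕ) [Fact p.Prime]
    (hp5 : 5 ≤ p) (hgood : V.HasGoodReductionAtPrime p) (hap : V.frobeniusTrace p = 0)
    (hns : ¬ ∀ m : ℕ, V.HasSurjectiveModNGaloisRep (p ^ m : ℕ)) :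
    ∃ K : IntermediateField ℚ (AlgebraicClosure ℚ), Module.finrank ℚ K = 2 ∧
      ∀ σ : absoluteGaloisGroup ℚ, σ ∈ K.fixingSubgroup ↔
        ∀ (τ : absoluteGaloisGroup ℚ) (P : V.geomTorsion p), σ • ((τ * τ) • P) = (τ * τ) • (σ • P) := by
  -- `AlgebraicClosure ℚ` carries two (definitionally equal) `ℚ`-algebra structures; register the Galois instances for the one
  -- found by instance search here (as in the tree's `GenEllCurve37aWitnesses`)
  haveI : Algebra.IsAlgebraic ℚ (AlgebraicClosure ℚ) := AlgebraicClosure.isAlgebraic ℚ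
  haveI : IsAlgClosure ℚ (AlgebraicClosure ℚ) := ⟨inferInstance, inferInstance⟩
  haveI : IsGalois ℚ (AlgebraicClosure ℚ) := IsGalois.mk
  have hp2 : p ≠ 2 := by omega
  obtain ⟨hss, hns'⟩ := goodSS_and_not_surj_of_row V p hp5 hgood hap hns
  obtain ⟨e, Φ, he, -⟩ := exists_frame_galoisRepTorsion_rat V p
  obtain ⟨k, hk, h2, hGN, hGC, hopen, hU2, -⟩ :=
    exists_index_two_subgroup_of_goodSS_of_not_surj V p Φ e he hp2 hss hns'
  set U : Subgroup (absoluteGaloisGroup ℚ) := ((unitGroup k).comap Φ.toMonoidHom).comap (galoisRepTorsion V p)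
    with hU
  have hUmem : ∀ σ : absoluteGaloisGroup ℚ, σ ∈ U ↔
      ∀ (τ : absoluteGaloisGroup ℚ) (P : V.geomTorsion p), σ • ((τ * τ) • P) = (τ * τ) • (σ • P) := fun σ => by
    rw [hU, mem_comap_cartan_iff]
    exact apply_mem_unitGroup_iff_centralizes_sq V p Φ e he hp2 hss hns' hk h2 hGN hGC σ
  -- `Γ_ℚ = Aut_ℚ(ℚ̄)` as a topological group (the identity: Mathlib derives both structures through the definition)
  let ι : absoluteGaloisGroup ℚ ≃ₜ* (AlgebraicClosure ℚ ≃ₐ[ℚ] AlgebraicClosure ℚ) :=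
    { MulEquiv.refl _ with
      continuous_toFun := continuous_id
      continuous_invFun := continuous_id }
  have hι : ∀ σ : absoluteGaloisGroup ℚ, ι.symm (ι σ) = σ := fun σ => ι.symm_apply_apply σ
  -- the same subgroup, typed over `Aut_ℚ(ℚ̄)`: open, hence closed, of index `2`
  let U' : Subgroup (AlgebraicClosure ℚ ≃ₐ[ℚ] AlgebraicClosure ℚ) := U.comap ι.symm.toMonoidHom
  have hU'mem : ∀ g : AlgebraicClosure ℚ ≃ₐ[ℚ] AlgebraicClosure ℚ, g ∈ U' ↔ ι.symm g ∈ U := fun g => Subgroup.mem_comap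
  have hopen' : IsOpen (U' : Set (AlgebraicClosure ℚ ≃ₐ[ℚ] AlgebraicClosure ℚ)) := by
    rw [Subgroup.coe_comap]
    exact hopen.preimage ι.symm.continuous
  have hclosed' : IsClosed (U' : Set (AlgebraicClosure ℚ ≃ₐ[ℚ] AlgebraicClosure ℚ)) := U'.isClosed_of_isOpen hopen'
  have hU'2 : U'.index = 2 := by
    rw [Subgroup.index_comap_of_surjective _ ι.symm.surjective]
    exact hU2
  let Uc : ClosedSubgroup (AlgebraicClosure ℚ ≃ₐ[ℚ] AlgebraicClosure ℚ) := ⟨U', hclosed'⟩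
  have hfix : (IntermediateField.fixedField (Uc : Subgroup (AlgebraicClosure ℚ ≃ₐ[ℚ] AlgebraicClosure ℚ))).fixingSubgroup = U' :=
    InfiniteGalois.fixingSubgroup_fixedField Uc
  refine ⟨IntermediateField.fixedField (Uc : Subgroup (AlgebraicClosure ℚ ≃ₐ[ℚ] AlgebraicClosure ℚ)), ?_, fun σ => ?_⟩
  · rw [IntermediateField.finrank_eq_fixingSubgroup_index, hfix]
    exact hU'2
  · have h1 : ι σ ∈ (IntermediateField.fixedField
        (Uc : Subgroup (AlgebraicClosure ℚ ≃ₐ[ℚ] AlgebraicClosure ℚ))).fixingSubgroup ↔ ι σ ∈ U' :=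
      Subgroup.ext_iff.mp hfix (ι σ)
    have h2 : ι σ ∈ U' ↔ σ ∈ U := by rw [hU'mem, hι]
    exact h1.trans (h2.trans (hUmem σ))

/-- **The Cartan field `K_V`: quadratic, unramified at `p` and at the good and multiplicative places, `p` inert, imaginary** — the
object form of `cartanSubgroup_local_of_row` / `quadraticChar_local_of_row`: on every row of crux 19606 there is `K ≤ ℚ̄` with
`[K : ℚ] = 2`, `Gal(ℚ̄/K) = H_V`, containing the inertia group of every prime of `ℤ̄` above `p` and above every good or multiplicative
place of `V` (unramified there), NOT containing some element of every decomposition group above `p` (`p` inert in `K`), and NOT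
containing any involution of `V[p]` inverting the `p`-th roots of unity (complex conjugation: `K` is imaginary). This `K` is the field of
the Hecke character `ψ` whose CM newform anchors the row (FINDING-19606-k8eta-c2-g10). [cite: Serre1972, §1.11 Prop. 12 d), §2.2, §4.2 c)]
[cite: Zywina2015, Thm. 1.4] -/
theorem exists_cartanField_local_of_row (V : WeierstrassCurve ℚ) [V.IsElliptic] [V.IsGloballyMinimal] (p : ℕ) [Fact p.Prime]
    (hp5 : 5 ≤ p) (hgood : V.HasGoodReductionAtPrime p) (hap : V.frobeniusTrace p = 0)
    (hns : ¬ ∀ m : ℕ, V.HasSurjectiveModNGaloisRep (p ^ m : ℕ)) :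
    ∃ K : IntermediateField ℚ (AlgebraicClosure ℚ), Module.finrank ℚ K = 2 ∧
      (∀ σ : absoluteGaloisGroup ℚ, σ ∈ K.fixingSubgroup ↔
        ∀ (τ : absoluteGaloisGroup ℚ) (P : V.geomTorsion p), σ • ((τ * τ) • P) = (τ * τ) • (σ • P)) ∧
      (∀ v : HeightOneSpectrum (𝓞 ℚ),
        ((p : 𝓞 ℚ) ∈ v.asIdeal ∨ V.HasGoodReductionAt v ∨ V.HasMultiplicativeReductionAt v) →
        ∀ 𝔔 ∈ v.primesAbove, ∀ σ ∈ 𝔔.inertia (absoluteGaloisGroup ℚ), σ ∈ K.fixingSubgroup) ∧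
      (∀ v : HeightOneSpectrum (𝓞 ℚ), (primesEquiv v : ℕ) = p →
        ∀ 𝔓 ∈ v.primesAbove, ∃ φ ∈ MulAction.stabilizer (absoluteGaloisGroup ℚ) 𝔓, φ ∉ K.fixingSubgroup) ∧
      (∀ σ : absoluteGaloisGroup ℚ, (∀ P : V.geomTorsion p, σ • (σ • P) = P) →
        (∀ t : AlgebraicClosure ℚ, t ^ p = 1 → σ • t = t⁻¹) → σ ∉ K.fixingSubgroup) := by
  obtain ⟨K, hK2, hKmem⟩ := exists_cartanField_of_row V p hp5 hgood hap hns
  refine ⟨K, hK2, hKmem, fun v hv 𝔔 h𝔔 σ hσ => ?_, fun v hv 𝔓 h𝔓 => ?_, fun σ hσσ hinv hmem => ?_⟩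
  · exact (hKmem σ).mpr (inertia_centralizes_sq_of_row V p hp5 hgood hap hns hv h𝔔 hσ)
  · obtain ⟨φ, hφ, hnot⟩ := forall_exists_frob_not_centralizes_sq_of_row V p hp5 hgood hap hns hv h𝔓
    exact ⟨φ, hφ, fun h => hnot ((hKmem φ).mp h)⟩
  · exact not_centralizes_sq_of_inverts_rootsOfUnity_of_row V p hp5 hgood hap hns hσσ hinv ((hKmem σ).mp hmem)

end Summit.BirchSwinnertonDyer.BirchSwinnertonDyer.Theorems.EtaCartanField

end
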